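import Mathlib
import Summits.ResolutionOfSingularities.ResolutionOfSingularities.Theorems.WeightedInvariantLocalWeightedDropWildMonicFlagDropAxisN0Transport
import Summits.ResolutionOfSingularities.ResolutionOfSingularities.Theorems.WeightedInvariantLocalWeightedDropWildMonicSCleanMax

/-!
# `WeightedInvariant.LocalWeightedDrop`, line `hasse-ridge-face-selection`, S3ρ: Uk-ρD1 — items (ii), (iii) and the `sFlag` half of (vii)
# of `AxisPackageN0`: the induced child hypersurface of a CLEAN parent hypersurface is valid, `d`-maximal and `s`-maximal

Crux item stmt-ResolutionOfSingularities-8899 `LocalWeightedDrop` (route `ResolutionOfSingularities/WeightedInvariant`), engine of the door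
`HypersurfaceCentreConstruction` stmt-ResolutionOfSingularities-19897.  [OURS · L1 W4.3, chain w43, res-D-pv-005 AS res-L1-w43-stub-7, hand of
Uk-ρD1 (`axisPackageN0_holds`, res-type-083's CUT 2026-08-27T09:03Z).  MODEL: S. Perlega, arXiv:2011.14443 Prop. 7.4.5 (p0093, «cleaning
transversal flags»: the clean hypersurface makes the flag VALID, `d`-MAXIMAL among the valid comparable flags and — secondary clean —
`s`-MAXIMAL over the hypersurfaces), applied at the CHILD through Prop. 6.1.1 (2) (`w`-cleanness is transported along the axis step:
res-D-pv-056's `isWClean_axisSucc_iff`, source weight `(w′₀, w′₀ + w′₁)`).  Nothing here is a statement of H. Hironaka's manuscript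
[claim: Hironaka2017, status: under-review]; OUR objects.]

For an axis step `x^{d−j}·T_j = A_j(x, xy)` with child `C = shift d T φ′`, a parent hypersurface `g₀` and its induced child hypersurface `g₀′`
(`…FlagDropAxisN0Transport.exists_induced_hypersurface`):
* `srcWeight_one_zero`, `srcWeight_zero_one`, `srcWeight_one_one` — the source weights of `(1,0)`, `(0,1)`, `(1,1)` are `(1,1)`, `(0,1)`, `(1,2)`;
* `isWClean_induced_iff` — the child tuple of `g₀′` is `w′`-clean iff the parent tuple of `g₀` is `(w′₀, w′₀+w′₁)`-clean;
* `isMMax_induced` — ITEM (ii): parent `(1,1)`-clean (and `(0,1)`-clean if `1 ∈ E`) ⇒ the induced child flag is VALID;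
* `dRes_le_induced_of_isMMax` — ITEM (iii): parent moreover `(1,2)`-clean ⇒ every valid child hypersurface has `d ≤ d(g₀′)`;
* `sFlag_le_induced_of_isMMax` — ITEM (vii), `sFlag` half: if moreover the induced child tuple is SECONDARY CLEAN with finite `s`, every valid
  child hypersurface with the same `d` has `sFlag ≤ s` (its setting is forced equal; then Prop. 5.2.5 `sFlag_shift_le_of_isSClean`).
-/

set_option linter.dupNamespace false -- mandated namespace of this single-conjunct summit

noncomputable section

namespace Summit.ResolutionOfSingularities.ResolutionOfSingularities.Theorems

namespace WildMonic

open MvPowerSeries MonicDescent Literature.AlgebraicGeometry.Resolution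
open PurePowerFlag (succE IsN0)

variable {k : Type} [Field k] {d : ℕ}

/-- `srcWeight (1,0) = (1,1)`. -/
theorem srcWeight_one_zero : srcWeight (![1, 0] : Fin 2 → ℕ) = ![1, 1] := by
  funext i; fin_cases i <;> simp [srcWeight]

/-- `srcWeight (0,1) = (0,1)`. -/
theorem srcWeight_zero_one : srcWeight (![0, 1] : Fin 2 → ℕ) = ![0, 1] := by
  funext i; fin_cases i <;> simp [srcWeight]

/-- `srcWeight (1,1) = (1,2)`. -/
theorem srcWeight_one_one : srcWeight (![1, 1] : Fin 2 → ℕ) = ![1, 2] := by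
  funext i; fin_cases i <;> simp [srcWeight]

section Child

variable (p : ℕ) {A T : Fin d → MvPowerSeries (Fin 2) k} (hA : IsPos d A) {φ' g₀ g₀' : MvPowerSeries (Fin 2) k}
  (hg₀ : constantCoeff g₀ = 0) (hg₀' : constantCoeff g₀' = 0)
  (hind : ∀ j : Fin d, (X 0 : MvPowerSeries (Fin 2) k) ^ (d - (j : ℕ)) * flagTuple d (shift d T φ') g₀' 0 j =
    subst (PlaneGerm.dirChart (0 : k)) (flagTuple d A g₀ 0 j))
  (hnzC : ∀ g : MvPowerSeries (Fin 2) k, constantCoeff g = 0 → (newtonSet (shift d (shift d T φ') g)).Nonempty)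

include hA hg₀ hind in
/-- PROP. 6.1.1 (2) for the induced pair: the child tuple of `g₀′` is `w′`-clean iff the parent tuple of `g₀` is `srcWeight w′`-clean. -/
theorem isWClean_induced_iff (w' : Fin 2 → ℕ) :
    IsWClean p w' (flagTuple d (shift d T φ') g₀' 0) ↔ IsWClean p (srcWeight w') (flagTuple d A g₀ 0) :=
  isWClean_axisSucc_iff _ _ hind p w' fun j => le_order_flagTuple hA hg₀ (map_zero _) j

variable [Fact p.Prime] [CharP k p]

include hA hg₀ hg₀' hind hnzC in
/-- ITEM (ii) OF `AxisPackageN0` (Prop. 7.4.5 (1) at the child): if the parent tuple of `g₀` is `(1,1)`-clean, and `(0,1)`-clean when `1 ∈ E`,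
the induced child flag `(g₀′, 0)` is VALID. -/
theorem isMMax_induced (E : Finset (Fin 2)) (h11 : IsWClean p ![1, 1] (flagTuple d A g₀ 0))
    (h01 : (1 : Fin 2) ∈ E → IsWClean p ![0, 1] (flagTuple d A g₀ 0)) :
    IsMMax d (shift d T φ') (succE (0 : k) E) g₀' 0 := by
  refine isMMax_zero_of_isWClean p (succE (0 : k) E) (shift d T φ') hnzC hg₀' (fun _ => ?_) (fun h1 => ?_)
  · rw [← flagTuple_zero_shear, isWClean_induced_iff p hA hg₀ hind, srcWeight_one_zero]; exact h11
  · rw [← flagTuple_zero_shear, isWClean_induced_iff p hA hg₀ hind, srcWeight_zero_one]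
    rw [succE_zero_eq_excNext, mem_excNext_iff] at h1
    rcases h1 with h | h
    · exact absurd h (by decide)
    · exact h01 h.1

include hA hg₀ hg₀' hind hnzC in
/-- ITEM (iii) OF `AxisPackageN0` (Prop. 7.4.5 (2) at the child): if the parent tuple of `g₀` is `(1,2)`-clean, EVERY valid child hypersurface
`g` has `d(g) ≤ d(g₀′)`. -/
theorem dRes_le_induced_of_isMMax (E : Finset (Fin 2)) (h12 : IsWClean p ![1, 2] (flagTuple d A g₀ 0))
    {g : MvPowerSeries (Fin 2) k} (hg : constantCoeff g = 0) (hval : IsMMax d (shift d T φ') (succE (0 : k) E) g 0) :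
    dRes (succE (0 : k) E) (newtonSet (flagTuple d (shift d T φ') g 0)) ≤
      dRes (succE (0 : k) E) (newtonSet (flagTuple d (shift d T φ') g₀' 0)) := by
  have h11C : IsWClean p ![1, 1] (flagTuple d (shift d T φ') g₀' 0) := by
    rw [isWClean_induced_iff p hA hg₀ hind, srcWeight_one_one]; exact h12
  rw [flagTuple_zero_shear] at h11C
  rw [flagTuple_zero_shear, flagTuple_zero_shear]
  have hN := hnzC g hg
  have hN₀ := hnzC g₀' hg₀'
  have hempty : newtonSet (0 : Fin d → MvPowerSeries (Fin 2) k) = ∅ := (newtonSet_eq_empty_iff _).2 fun _ => rfl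
  have hne₀ : shift d (shift d T φ') g₀' ≠ 0 := fun h => by
    rw [h, hempty] at hN₀
    exact Set.not_nonempty_empty hN₀
  -- `m_{(1,1)}` does not exceed that of the clean representative
  have hm := wMin_shift_le_of_isWClean_shift p ![1, 1] (shift d T φ') h11C (wMin_ne_top_of_ne_zero _ hne₀) g
  obtain ⟨a1, -, -⟩ := wMin_eq_of_newtonSet_nonempty (succE (0 : k) E) _ hN
  obtain ⟨b1, -, -⟩ := wMin_eq_of_newtonSet_nonempty (succE (0 : k) E) _ hN₀
  rw [a1, b1, Nat.cast_le] at hm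
  -- validity of `g`: its `m = r₀ + r₁` dominates that of `g₀′`
  have hv := hval g₀' hg₀'
  rw [mOf_of_isN0 (Or.inr rfl), mOf_of_isN0 (Or.inr rfl), flagTuple_zero_shear, flagTuple_zero_shear] at hv
  omega

include hA hg₀ hg₀' hind hnzC in
/-- ITEM (vii) OF `AxisPackageN0`, `sFlag` HALF (Prop. 7.4.5 (3) at the child): if the parent tuple of `g₀` is `(1,1)`-clean and `(0,1)`-clean when
`1 ∈ E`, and the induced child tuple is SECONDARY CLEAN with finite `s`, then every VALID child hypersurface `g` with the same `d` has
`sFlag ≤ s` — its setting is forced to be that of `g₀′`, and Prop. 5.2.5 applies. -/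
theorem sFlag_le_induced_of_isMMax (E : Finset (Fin 2)) (h11 : IsWClean p ![1, 1] (flagTuple d A g₀ 0))
    (h01 : (1 : Fin 2) ∈ E → IsWClean p ![0, 1] (flagTuple d A g₀ 0))
    {s : ℕ} (hs : sFlag (succE (0 : k) E) (newtonSet (flagTuple d (shift d T φ') g₀' 0)) = s)
    (hsc : IsSClean p (succE (0 : k) E) (flagTuple d (shift d T φ') g₀' 0))
    {g : MvPowerSeries (Fin 2) k} (hg : constantCoeff g = 0) (hval : IsMMax d (shift d T φ') (succE (0 : k) E) g 0)
    (hd : dRes (succE (0 : k) E) (newtonSet (flagTuple d (shift d T φ') g 0)) =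
      dRes (succE (0 : k) E) (newtonSet (flagTuple d (shift d T φ') g₀' 0))) :
    sFlag (succE (0 : k) E) (newtonSet (flagTuple d (shift d T φ') g 0)) ≤ s := by
  have h10C : IsWClean p ![1, 0] (flagTuple d (shift d T φ') g₀' 0) := by
    rw [isWClean_induced_iff p hA hg₀ hind, srcWeight_one_zero]; exact h11
  have h01C : (1 : Fin 2) ∈ succE (0 : k) E → IsWClean p ![0, 1] (flagTuple d (shift d T φ') g₀' 0) := by
    intro h1
    rw [isWClean_induced_iff p hA hg₀ hind, srcWeight_zero_one]
    rw [succE_zero_eq_excNext, mem_excNext_iff] at h1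
    rcases h1 with h | h
    · exact absurd h (by decide)
    · exact h01 h.1
  rw [flagTuple_zero_shear] at h10C h01C hs hsc hd
  rw [flagTuple_zero_shear] at hd ⊢
  have hN := hnzC g hg
  have hN₀ := hnzC g₀' hg₀'
  have hempty : newtonSet (0 : Fin d → MvPowerSeries (Fin 2) k) = ∅ := (newtonSet_eq_empty_iff _).2 fun _ => rfl
  have hne₀ : shift d (shift d T φ') g₀' ≠ 0 := fun h => by
    rw [h, hempty] at hN₀
    exact Set.not_nonempty_empty hN₀
  obtain ⟨-, a2, a3⟩ := wMin_eq_of_newtonSet_nonempty (succE (0 : k) E) _ hN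
  obtain ⟨-, b2, b3⟩ := wMin_eq_of_newtonSet_nonempty (succE (0 : k) E) _ hN₀
  -- the exceptional exponents of `g` are componentwise `≤` those of `g₀′` …
  have hr0 : excExp (succE (0 : k) E) (newtonSet (shift d (shift d T φ') g)) 0 ≤
      excExp (succE (0 : k) E) (newtonSet (shift d (shift d T φ') g₀')) 0 := by
    have h0 : (0 : Fin 2) ∈ succE (0 : k) E := by rw [succE_zero_eq_excNext, mem_excNext_iff]; exact Or.inl rfl
    have h := wMin_shift_le_of_isWClean_shift p ![1, 0] (shift d T φ') h10C (wMin_ne_top_of_ne_zero _ hne₀) g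
    rw [a2 h0, b2 h0] at h
    exact_mod_cast h
  have hr1 : excExp (succE (0 : k) E) (newtonSet (shift d (shift d T φ') g)) 1 ≤
      excExp (succE (0 : k) E) (newtonSet (shift d (shift d T φ') g₀')) 1 := by
    by_cases h1 : (1 : Fin 2) ∈ succE (0 : k) E
    · have h := wMin_shift_le_of_isWClean_shift p ![0, 1] (shift d T φ') (h01C h1) (wMin_ne_top_of_ne_zero _ hne₀) g
      rw [a3 h1, b3 h1] at h
      exact_mod_cast h
    · rw [excExp_apply_one, excExp_apply_one, if_neg h1, if_neg h1]
  -- … and their sum is `≥` by validity: so they are equal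
  have hv := hval g₀' hg₀'
  rw [mOf_of_isN0 (Or.inr rfl), mOf_of_isN0 (Or.inr rfl), flagTuple_zero_shear, flagTuple_zero_shear] at hv
  have hr0' : excExp (succE (0 : k) E) (newtonSet (shift d (shift d T φ') g)) 0 =
      excExp (succE (0 : k) E) (newtonSet (shift d (shift d T φ') g₀')) 0 := by omega
  have hr1' : excExp (succE (0 : k) E) (newtonSet (shift d (shift d T φ') g)) 1 =
      excExp (succE (0 : k) E) (newtonSet (shift d (shift d T φ') g₀')) 1 := by omega
  have hr : excExp (succE (0 : k) E) (newtonSet (shift d (shift d T φ') g)) =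
      excExp (succE (0 : k) E) (newtonSet (shift d (shift d T φ') g₀')) := by
    ext i
    fin_cases i
    · exact hr0'
    · exact hr1'
  -- Prop. 5.2.5 at the secondary clean child tuple
  have h := sFlag_shift_le_of_isSClean p (succE (0 : k) E) (shift d (shift d T φ') g₀') (succE (0 : k) E) (g - g₀') hs hsc
    (by rw [shift_shift, sub_add_cancel]; exact hd) (by rw [shift_shift, sub_add_cancel]; exact hr)
  rwa [shift_shift, sub_add_cancel] at h

end Child

end WildMonic

end Summit.ResolutionOfSingularities.ResolutionOfSingularities.Theorems

end
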